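/-
Copyright (c) 2026 the pub-hodgecm-mathlib formalisation cell (harness21).  Prover seat hodgecm-mathlib-K2E3-p21 (g4), Track B «K2-LIT» ∕ h413
(`stmt-HodgeConjecture-24833`), line `K2_E3_EllipticInputs`, unit U12 §L, Richardson road for (LBGL-ge3) at `N = 3` (road owner K2E3-p11 (g4), deal (F-E)-D′
2026-09-04T05:21Z), part 2 of 2: «THE WEIGHTED LEVI-SLICE FUNCTIONAL OF THE (2,1) PARABOLIC OF `𝔤𝔩₃(F)` IS `Ad(GL₃(F))`-INVARIANT».  2026-09-04.
-/
import Summits.HodgeConjecture.HodgeConjecture.Theorems.K2E3GL3LeviSliceAdInvariant       -- part 1 (this seat): `lintegral_pi_weight_conj_mul_levi_eq`, `measurable_lintegral_pi_weight_conj`, `measurable_weight_mul_conj`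
import Summits.HodgeConjecture.HodgeConjecture.Theorems.K2E3GLnRichardsonMeasureRadon    -- ★ p857384 (this seat): `sFinite_haar_unipotentRadicalGL`
import Literature.MeasureTheory.Group.InvariantQuotientExistence                         -- ★ `exists_smulInvariantMeasure_integral_fiberIntegral_eq`, ★ `measurable_quotient_iff`
import HarnessLib

/-!
# K2_E3 road (h413), §L — Richardson road for (LBGL-ge3) at `N = 3`, brick (F-E)-D′: the weighted Levi-slice functional of `𝔭_{(2,1)} ⊂ 𝔤𝔩₃(F)`
# `h ↦ ∫_{𝔪} w(χ(m)) ∫_{K×U} h(Ad(k u) M(m)) d(κ⊗μ_U) dm` is `Ad(GL₃(F))`-invariant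

Cell `pub/hodgecm-mathlib` (D-0151), Track B, seat K2E3-p21 (g4); road owner K2E3-p11 (g4) (05:21:40Z: «(F-E)-D′ … the (2,1) twin of p03's ★-GREEN D: the invariant
object is `∫⁻_m |χ(m)| ∫⁻_{K×U} h(Ad(k u) M(m))` (the `dm`-integral makes `g ↦ ∫ |χ| h(Ad g M) dm` right-`M_c`-invariant); ★ `exists_quotientMeasure_levi_eq_smul_map`
+ `SMulInvariantMeasure` on `G ⧸ M_c` + lift by `Quotient.liftOn'`»), §L lead K2E3-p12 (g4), dealer K2E3-plan (g3).  `--supports stmt-HodgeConjecture-24833 --as helper`;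
THEOREMS ONLY (no definition ∕ instance ∕ notation ∕ named fact ∕ `sorry`); never imports `Cruxes/…/Lines`.  COUNT-NEUTRAL ((LBGL-ge3) stays OPEN).  Template: ★ K2E3-p03 (g4)
`K2E3GL3KNOrbitalAdInvariant.GLn.lintegral_prod_conj_eq_of_offDiag_eq_zero` (the split-torus case), with the orbit map replaced by a DESCENDED right-`M_c`-invariant functional.

THE MATHEMATICS.  `G = GL₃(F)`, `K = GL₃(𝒪)` (`glInt`), `P = P_{(2,1)} = M_c U_c` for the two-block labelling `c = (false,false,true)`, `M_c ≅ GL₂ × GL₁` block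
diagonal, `U = U_c`; `𝔪 = 𝔪_c ≅ F⁵` via `M(m) = [[m₀,m₁,0],[m₂,m₃,0],[0,0,m₄]]`, `χ(m) = χ_{[[m₀,m₁],[m₂,m₃]]}(m₄)`.
* §1 (any `n`, any MONOTONE two-block `c`): if `Ψ ≥ 0` is Borel on `G` and right-`M_c`-invariant, then **`∫_{K×U_c} Ψ(g k u) = ∫_{K×U_c} Ψ(k u)`** for every
  `g ∈ G`: `Ψ` descends to `G ⧸ M_c` (`Quotient.liftOn'`, Borel by ★ `measurable_quotient_iff`), `G ⧸ M_c` carries a non-zero `G`-invariant Radon measure `μ`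
  (`G`, `M_c` unimodular; ★ `exists_smulInvariantMeasure_integral_fiberIntegral_eq`) of Iwasawa form `μ = C • ((k,u) ↦ k u M_c)_*(κ ⊗ μ_U)` (★
  `exists_quotientMeasure_levi_eq_smul_map_bool`), and `∫ Ψ(g • y) dμ = ∫ Ψ dμ` (`MeasureTheory.map_smul`).
* part 1 ★ `K2E3GL3LeviSliceAdInvariant` (`n = 3`, `c = (2,1)`): for `a ∈ M_c`, `Ad(a)` preserves `𝔪` and acts on the coordinates `m` by the linear map `T(a, a⁻¹) = (P ⊗ Qᵀ) ⊕ (a₂₂ (a⁻¹)₂₂)`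
  (`P`, `Q` the `2×2` blocks of `a`, `a⁻¹`), of determinant `(det P · det Q)² · a₂₂(a⁻¹)₂₂ = 1`; hence Lebesgue measure `dm = dx^{⊗5}` on `𝔪` is `Ad(M_c)`-invariant
  (★ `lintegral_comp_linearEquiv`), `χ(Ad(a) m) = χ(m)` (`Matrix.charpoly_mul_comm`), and `Ψ_h(y) = ∫_𝔪 w(χ(m)) h(y M(m) y⁻¹) dm` is right-`M_c`-invariant and Borel.
* §2 the heads: **`∫⁻_m w(χ m) ∫⁻_{K×U} h(Ad(g k u) M(m)) = ∫⁻_m w(χ m) ∫⁻_{K×U} h(Ad(k u) M(m))`** for every Borel `w, h ≥ 0`, every `g` (Tonelli + §4), and its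
  `w = |·|_F` instance — the (2,1) input of the `𝔭`-slice form of the Richardson road (E′∕G′, K2E3-p11 (g4)).
[HarishChandra1970, Part V §2 p. 49 (invariance of `∫_{G/M}`)]; [Rogawski1990, §4.13 p. 70 (`G = KP`, `P = MU`, the quotient measure on `G ⧸ M`)];
[Gelbart1975, Thm. 9.22 (iii)]; [DeitmarEchterhoff2014, Thm. 1.5.3].

HONEST LABEL: HC_CM is proved only modulo the 7 printed citations (2 remaining named inputs: hLiu418 = stmt-HodgeConjecture-24832, h413 = stmt-HodgeConjecture-24833)
until rung 0 closes; count-neutral helper.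
-/

set_option autoImplicit false
set_option linter.dupNamespace false   -- `Summit.HodgeConjecture.HodgeConjecture.…` (D-0017 nested layout; lakefile exemption for Summits)

noncomputable section

open MeasureTheory MeasureTheory.Measure Filter Topology TopologicalSpace Polynomial Function
open scoped MatrixGroups NNReal ENNReal
open Literature.MeasureTheory.Group
open Literature.NumberTheory.Automorphic
open Literature.NumberTheory.GaloisRepresentations Literature.NumberTheory.GaloisRepresentations.IsNonarchimedeanLocalField
open Summit.HodgeConjecture.HodgeConjecture.Cruxes.H413.K2E3GLnRichardsonMeasureRadon
open Summit.HodgeConjecture.HodgeConjecture.Cruxes.H413.K2E3GL3LeviSliceAdInvariant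

namespace Summit.HodgeConjecture.HodgeConjecture.Cruxes.H413.K2E3GL3ParabolicSliceAdInvariant

/-! ## §1  Right-`M_c`-invariant Borel functions have left-`G`-invariant `K × U_c`-integrals (any `n`, any monotone two-block `c`) -/

section GLn

variable {F : Type*} [Field F] [ValuativeRel F] [TopologicalSpace F] [IsNonarchimedeanLocalField F] {n : ℕ} {c : Fin n → Bool}
  [MeasurableSpace (GL (Fin n) F)] [BorelSpace (GL (Fin n) F)]

/-- **Left-`G`-invariance of the `K × U_c`-integral of a right-`M_c`-invariant function.**  `c : Fin n → Bool` monotone (a standard two-block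
parabolic `P_c = M_c U_c` of `GL_n(F)`), `κ`, `μ_U` Haar measures on `K = GL_n(𝒪)` and `U_c`.  If `Ψ : GL_n(F) → [0, ∞]` is Borel and `Ψ(y a) = Ψ(y)` for all
`a ∈ M_c`, then **`∫⁻_{K×U_c} Ψ(g k u) d(κ ⊗ μ_U) = ∫⁻_{K×U_c} Ψ(k u) d(κ ⊗ μ_U)`** for every `g ∈ GL_n(F)`: `Ψ` descends to `G ⧸ M_c`, which carries a non-zero
`G`-invariant Radon measure (`G`, `M_c` unimodular) of Iwasawa form `C • ((k,u) ↦ k u M_c)_*(κ ⊗ μ_U)`.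
[cite: HarishChandra1970, Part V §2 p. 49] [cite: Rogawski1990, §4.13 p. 70] [cite: Gelbart1975, Thm. 9.22 (iii)] [cite: DeitmarEchterhoff2014, Thm. 1.5.3] -/
theorem GLn.lintegral_prod_eq_of_forall_mul_levi_eq (hc : Monotone c)
    (κ : Measure ↥(glInt n F)) [IsHaarMeasure κ] (μN : Measure ↥(unipotentRadicalGL F c)) [IsHaarMeasure μN]
    {Ψ : GL (Fin n) F → ℝ≥0∞} (hΨ : Measurable Ψ) (hΨA : ∀ y : GL (Fin n) F, ∀ a ∈ standardLeviGL F c, Ψ (y * a) = Ψ y) (g : GL (Fin n) F) :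
    ∫⁻ q : ↥(glInt n F) × ↥(unipotentRadicalGL F c), Ψ (g * ((q.1 : GL (Fin n) F) * (q.2 : GL (Fin n) F))) ∂(κ.prod μN) =
      ∫⁻ q : ↥(glInt n F) × ↥(unipotentRadicalGL F c), Ψ ((q.1 : GL (Fin n) F) * (q.2 : GL (Fin n) F)) ∂(κ.prod μN) := by
  classical
  -- point-set and measure-theoretic instances (as in ★ `K2E3GL3KNOrbitalAdInvariant`)
  haveI : T2Space F := (isLocalField F).toT2Space
  haveI : SecondCountableTopology F := secondCountableTopology_localField F
  haveI : LocallyCompactSpace F := (isLocalField F).toLocallyCompactSpace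
  haveI : SecondCountableTopology (Matrix (Fin n) (Fin n) F) := inferInstanceAs (SecondCountableTopology (Fin n → Fin n → F))
  haveI : SecondCountableTopology (Matrix (Fin n) (Fin n) F)ᵐᵒᵖ := MulOpposite.opHomeomorph.symm.secondCountableTopology
  haveI : SecondCountableTopology (GL (Fin n) F) := Units.isEmbedding_embedProduct.secondCountableTopology
  haveI : LocallyCompactSpace (Matrix (Fin n) (Fin n) F) := inferInstanceAs (LocallyCompactSpace (Fin n → Fin n → F))
  haveI : LocallyCompactSpace (GL (Fin n) F) := inferInstance
  haveI : T2Space (GL (Fin n) F) := inferInstance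
  haveI : SecondCountableTopology ↥(glInt n F) := TopologicalSpace.Subtype.secondCountableTopology _
  haveI : SecondCountableTopology ↥(unipotentRadicalGL F c) := TopologicalSpace.Subtype.secondCountableTopology _
  haveI : BorelSpace ↥(glInt n F) := Subtype.borelSpace _
  haveI : BorelSpace ↥(unipotentRadicalGL F c) := Subtype.borelSpace _
  haveI : BorelSpace (↥(glInt n F) × ↥(unipotentRadicalGL F c)) := Prod.borelSpace
  -- the Levi subgroup `A = M_c`, closed and unimodular, and an invariant Radon measure on `G ⧸ A`
  set A : Subgroup (GL (Fin n) F) := standardLeviGL F c with hAdef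
  have hAc : IsClosed ((A : Subgroup (GL (Fin n) F)) : Set (GL (Fin n) F)) := isClosed_standardLeviGL (R := F) c
  letI : MeasurableSpace (GL (Fin n) F ⧸ A) := borel _
  haveI : BorelSpace (GL (Fin n) F ⧸ A) := ⟨rfl⟩
  haveI : BorelSpace ↥A := Subtype.borelSpace _
  haveI : LocallyCompactSpace ↥A := hAc.locallyCompactSpace
  haveI : SecondCountableTopology ↥A := TopologicalSpace.Subtype.secondCountableTopology _
  haveI : (haar : Measure (GL (Fin n) F)).IsMulRightInvariant := GLn.isMulRightInvariant_of_isHaarMeasure_local n F _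
  haveI : (haar : Measure ↥A).IsInvInvariant := isInvInvariant_haar_standardLeviGL F c _
  obtain ⟨μ, hμinv, hμreg, hμ0, -⟩ :=
    exists_smulInvariantMeasure_integral_fiberIntegral_eq A (haar : Measure ↥A) hAc (haar : Measure (GL (Fin n) F))
  haveI := hμinv
  haveI := hμreg
  -- the Iwasawa form of `μ`
  obtain ⟨C, hC, hμC⟩ := exists_quotientMeasure_levi_eq_smul_map_bool F hc hAdef μ hμ0 κ μN
  -- `Ψ` descends to `Φ : G ⧸ A → [0, ∞]`, Borel
  set Φ : GL (Fin n) F ⧸ A → ℝ≥0∞ := fun y =>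
    Quotient.liftOn' y Ψ (fun a b hab => by
      rw [QuotientGroup.leftRel_apply] at hab
      calc Ψ a = Ψ (a * (a⁻¹ * b)) := (hΨA a _ hab).symm
        _ = Ψ b := by rw [mul_inv_cancel_left]) with hΦdef
  have hΦmk : Φ ∘ (QuotientGroup.mk : GL (Fin n) F → GL (Fin n) F ⧸ A) = Ψ := rfl
  have hΦm : Measurable Φ := (measurable_quotient_iff hAc).2 (by rw [hΦmk]; exact hΨ)
  -- the Iwasawa parametrisation `(k, u) ↦ k u A`
  have hπ : Measurable fun q : ↥(glInt n F) × ↥(unipotentRadicalGL F c) =>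
      (QuotientGroup.mk ((q.1 : GL (Fin n) F) * (q.2 : GL (Fin n) F)) : GL (Fin n) F ⧸ A) :=
    ((QuotientGroup.continuous_mk (N := A)).comp ((continuous_subtype_val.comp continuous_fst).mul
      (continuous_subtype_val.comp continuous_snd))).measurable
  -- `∫⁻ Φ dμ = C • RHS` and `∫⁻ Φ(g • ·) dμ = C • LHS`
  have e1 : ∫⁻ y, Φ y ∂μ = C • ∫⁻ q : ↥(glInt n F) × ↥(unipotentRadicalGL F c), Ψ ((q.1 : GL (Fin n) F) * (q.2 : GL (Fin n) F)) ∂(κ.prod μN) := by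
    rw [hμC, lintegral_smul_measure, lintegral_map hΦm hπ]
    rfl
  have e2 : ∫⁻ y, Φ (g • y) ∂μ = C • ∫⁻ q : ↥(glInt n F) × ↥(unipotentRadicalGL F c), Ψ (g * ((q.1 : GL (Fin n) F) * (q.2 : GL (Fin n) F))) ∂(κ.prod μN) := by
    have hΦg : Measurable fun y : GL (Fin n) F ⧸ A => Φ (g • y) := hΦm.comp (measurable_const_smul g)
    rw [hμC, lintegral_smul_measure, lintegral_map hΦg hπ]
    rfl
  -- invariance of `μ` under `g`
  have e3 : ∫⁻ y, Φ (g • y) ∂μ = ∫⁻ y, Φ y ∂μ := by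
    calc ∫⁻ y, Φ (g • y) ∂μ = ∫⁻ y, Φ y ∂(Measure.map (fun y : GL (Fin n) F ⧸ A => g • y) μ) := (lintegral_map hΦm (measurable_const_smul g)).symm
      _ = ∫⁻ y, Φ y ∂μ := by rw [MeasureTheory.map_smul]
  rw [e1, e2, ENNReal.smul_def, ENNReal.smul_def, smul_eq_mul, smul_eq_mul] at e3
  exact (ENNReal.mul_right_inj (ENNReal.coe_ne_zero.2 hC) ENNReal.coe_ne_top).1 e3

end GLn

/-! ## §2  The heads (`N = 3`, `c = (2,1)`): the weighted Levi-slice functional is `Ad(GL₃(F))`-invariant -/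

section GL3

variable {F : Type*} [Field F] [ValuativeRel F] [TopologicalSpace F] [IsNonarchimedeanLocalField F] [MeasurableSpace F] [BorelSpace F]
  [MeasurableSpace (GL (Fin 3) F)] [BorelSpace (GL (Fin 3) F)]
  [MeasurableSpace (Matrix (Fin 3) (Fin 3) F)] [BorelSpace (Matrix (Fin 3) (Fin 3) F)]

/-- **(F-E)-D′, `(k,u)` OUTSIDE.**  `K = GL₃(𝒪)`, `U = U_{(2,1)}`, `κ`, `μ_U` Haar, `dx` additive Haar on `F`, `w : F → [0,∞]` and `h : 𝔤𝔩₃(F) → [0,∞]` Borel,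
`g ∈ GL₃(F)`.  Then **`∫⁻_{K×U} ∫⁻_m w(χ(m)) h(Ad(g k u) M(m)) dm d(κ⊗μ_U) = ∫⁻_{K×U} ∫⁻_m w(χ(m)) h(Ad(k u) M(m)) dm d(κ⊗μ_U)`**,
`M(m) = [[m₀,m₁,0],[m₂,m₃,0],[0,0,m₄]]`, `χ(m) = χ_{[[m₀,m₁],[m₂,m₃]]}(m₄)` (§1 applied to the right-`M_c`-invariant Borel functional `Ψ_h` of part 1).
[cite: HarishChandra1970, Part V §2 p. 49] [cite: Rogawski1990, §4.13 p. 70] [cite: Gelbart1975, Thm. 9.22 (iii)] -/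
theorem GL3.lintegral_prod_lintegral_pi_conj_leviBlock_eq
    (κ : Measure ↥(glInt 3 F)) [IsHaarMeasure κ] (μU : Measure ↥(unipotentRadicalGL F (![false, false, true] : Fin 3 → Bool))) [IsHaarMeasure μU]
    (dx : Measure F) [dx.IsAddHaarMeasure] {w : F → ℝ≥0∞} (hw : Measurable w) (g : GL (Fin 3) F) {h : Matrix (Fin 3) (Fin 3) F → ℝ≥0∞} (hh : Measurable h) :
    ∫⁻ q : ↥(glInt 3 F) × ↥(unipotentRadicalGL F (![false, false, true] : Fin 3 → Bool)), ∫⁻ m : Fin 5 → F,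
        w ((!![m 0, m 1; m 2, m 3] : Matrix (Fin 2) (Fin 2) F).charpoly.eval (m 4)) *
          h (((g * ((q.1 : GL (Fin 3) F) * (q.2 : GL (Fin 3) F)) : GL (Fin 3) F) : Matrix (Fin 3) (Fin 3) F) * !![m 0, m 1, 0; m 2, m 3, 0; 0, 0, m 4] *
            (((g * ((q.1 : GL (Fin 3) F) * (q.2 : GL (Fin 3) F)))⁻¹ : GL (Fin 3) F) : Matrix (Fin 3) (Fin 3) F)) ∂(Measure.pi fun _ : Fin 5 => dx) ∂(κ.prod μU) =
      ∫⁻ q : ↥(glInt 3 F) × ↥(unipotentRadicalGL F (![false, false, true] : Fin 3 → Bool)), ∫⁻ m : Fin 5 → F,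
        w ((!![m 0, m 1; m 2, m 3] : Matrix (Fin 2) (Fin 2) F).charpoly.eval (m 4)) *
          h ((((q.1 : GL (Fin 3) F) * (q.2 : GL (Fin 3) F) : GL (Fin 3) F) : Matrix (Fin 3) (Fin 3) F) * !![m 0, m 1, 0; m 2, m 3, 0; 0, 0, m 4] *
            ((((q.1 : GL (Fin 3) F) * (q.2 : GL (Fin 3) F))⁻¹ : GL (Fin 3) F) : Matrix (Fin 3) (Fin 3) F)) ∂(Measure.pi fun _ : Fin 5 => dx) ∂(κ.prod μU) := by
  have hmono : Monotone (![false, false, true] : Fin 3 → Bool) := by decide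
  exact GLn.lintegral_prod_eq_of_forall_mul_levi_eq hmono κ μU (measurable_lintegral_pi_weight_conj dx w hw h hh)
    (fun y a ha => lintegral_pi_weight_conj_mul_levi_eq dx w h y ha) g

/-- **(F-E)-D′, `m` OUTSIDE (the road owner's object).**  Same data; **`∫⁻_m w(χ(m)) ∫⁻_{K×U} h(Ad(g k u) M(m)) d(κ⊗μ_U) dm = ∫⁻_m w(χ(m)) ∫⁻_{K×U} h(Ad(k u) M(m)) d(κ⊗μ_U) dm`**
(Tonelli on `(K×U) × F⁵` and `GL3.lintegral_prod_lintegral_pi_conj_leviBlock_eq`): the distribution `h ↦ ∫_𝔪 w(χ) ∫_{K×U} h(Ad(k u) M) ` on `𝔤𝔩₃(F)` is `Ad(GL₃(F))`-invariant.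
[cite: HarishChandra1970, Part V §2 p. 49] [cite: Rogawski1990, §4.13 p. 70] [cite: Gelbart1975, Thm. 9.22 (iii)] -/
theorem GL3.lintegral_pi_mul_lintegral_prod_conj_leviBlock_eq
    (κ : Measure ↥(glInt 3 F)) [IsHaarMeasure κ] (μU : Measure ↥(unipotentRadicalGL F (![false, false, true] : Fin 3 → Bool))) [IsHaarMeasure μU]
    (dx : Measure F) [dx.IsAddHaarMeasure] {w : F → ℝ≥0∞} (hw : Measurable w) (g : GL (Fin 3) F) {h : Matrix (Fin 3) (Fin 3) F → ℝ≥0∞} (hh : Measurable h) :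
    ∫⁻ m : Fin 5 → F, w ((!![m 0, m 1; m 2, m 3] : Matrix (Fin 2) (Fin 2) F).charpoly.eval (m 4)) *
        ∫⁻ q : ↥(glInt 3 F) × ↥(unipotentRadicalGL F (![false, false, true] : Fin 3 → Bool)),
          h (((g * ((q.1 : GL (Fin 3) F) * (q.2 : GL (Fin 3) F)) : GL (Fin 3) F) : Matrix (Fin 3) (Fin 3) F) * !![m 0, m 1, 0; m 2, m 3, 0; 0, 0, m 4] *
            (((g * ((q.1 : GL (Fin 3) F) * (q.2 : GL (Fin 3) F)))⁻¹ : GL (Fin 3) F) : Matrix (Fin 3) (Fin 3) F)) ∂(κ.prod μU) ∂(Measure.pi fun _ : Fin 5 => dx) =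
      ∫⁻ m : Fin 5 → F, w ((!![m 0, m 1; m 2, m 3] : Matrix (Fin 2) (Fin 2) F).charpoly.eval (m 4)) *
        ∫⁻ q : ↥(glInt 3 F) × ↥(unipotentRadicalGL F (![false, false, true] : Fin 3 → Bool)),
          h ((((q.1 : GL (Fin 3) F) * (q.2 : GL (Fin 3) F) : GL (Fin 3) F) : Matrix (Fin 3) (Fin 3) F) * !![m 0, m 1, 0; m 2, m 3, 0; 0, 0, m 4] *
            ((((q.1 : GL (Fin 3) F) * (q.2 : GL (Fin 3) F))⁻¹ : GL (Fin 3) F) : Matrix (Fin 3) (Fin 3) F)) ∂(κ.prod μU) ∂(Measure.pi fun _ : Fin 5 => dx) := by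
  classical
  haveI : T2Space F := (isLocalField F).toT2Space
  haveI : SecondCountableTopology F := secondCountableTopology_localField F
  haveI : LocallyCompactSpace F := (isLocalField F).toLocallyCompactSpace
  haveI : IsTopologicalRing F := inferInstance
  haveI : SecondCountableTopology (Matrix (Fin 3) (Fin 3) F) := inferInstanceAs (SecondCountableTopology (Fin 3 → Fin 3 → F))
  haveI : SecondCountableTopology (Matrix (Fin 3) (Fin 3) F)ᵐᵒᵖ := MulOpposite.opHomeomorph.symm.secondCountableTopology
  haveI : SecondCountableTopology (GL (Fin 3) F) := Units.isEmbedding_embedProduct.secondCountableTopology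
  haveI : SecondCountableTopology ↥(glInt 3 F) := TopologicalSpace.Subtype.secondCountableTopology _
  haveI : SecondCountableTopology ↥(unipotentRadicalGL F (![false, false, true] : Fin 3 → Bool)) := TopologicalSpace.Subtype.secondCountableTopology _
  haveI : BorelSpace ↥(glInt 3 F) := Subtype.borelSpace _
  haveI : BorelSpace ↥(unipotentRadicalGL F (![false, false, true] : Fin 3 → Bool)) := Subtype.borelSpace _
  haveI : BorelSpace (↥(glInt 3 F) × ↥(unipotentRadicalGL F (![false, false, true] : Fin 3 → Bool))) := Prod.borelSpace
  haveI : CompactSpace ↥(glInt 3 F) := isCompact_iff_compactSpace.1 (isCompact_glInt 3 F)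
  haveI : IsFiniteMeasure κ := CompactSpace.isFiniteMeasure
  haveI : SFinite μU := sFinite_haar_unipotentRadicalGL μU
  haveI : SFinite dx := inferInstance
  -- the joint integrand is Borel on `F⁵ × (K×U)` (for `g`, and for `g = 1`), and Borel in `q` for fixed `m`
  have hF : ∀ g : GL (Fin 3) F, Measurable (uncurry fun (m : Fin 5 → F) (q : ↥(glInt 3 F) × ↥(unipotentRadicalGL F (![false, false, true] : Fin 3 → Bool))) =>
      w ((!![m 0, m 1; m 2, m 3] : Matrix (Fin 2) (Fin 2) F).charpoly.eval (m 4)) *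
        h (((g * ((q.1 : GL (Fin 3) F) * (q.2 : GL (Fin 3) F)) : GL (Fin 3) F) : Matrix (Fin 3) (Fin 3) F) * !![m 0, m 1, 0; m 2, m 3, 0; 0, 0, m 4] *
          (((g * ((q.1 : GL (Fin 3) F) * (q.2 : GL (Fin 3) F)))⁻¹ : GL (Fin 3) F) : Matrix (Fin 3) (Fin 3) F))) := fun g => by
    have hθ : Measurable fun p : (Fin 5 → F) × (↥(glInt 3 F) × ↥(unipotentRadicalGL F (![false, false, true] : Fin 3 → Bool))) =>
        ((g * ((p.2.1 : GL (Fin 3) F) * (p.2.2 : GL (Fin 3) F)) : GL (Fin 3) F), p.1) :=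
      ((continuous_const.mul ((continuous_subtype_val.comp (continuous_fst.comp continuous_snd)).mul
        (continuous_subtype_val.comp (continuous_snd.comp continuous_snd)))).measurable).prodMk measurable_fst
    exact (measurable_weight_mul_conj w hw h hh).comp hθ
  have hq : ∀ (g : GL (Fin 3) F) (m : Fin 5 → F), Measurable fun q : ↥(glInt 3 F) × ↥(unipotentRadicalGL F (![false, false, true] : Fin 3 → Bool)) =>
      h (((g * ((q.1 : GL (Fin 3) F) * (q.2 : GL (Fin 3) F)) : GL (Fin 3) F) : Matrix (Fin 3) (Fin 3) F) * !![m 0, m 1, 0; m 2, m 3, 0; 0, 0, m 4] *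
        (((g * ((q.1 : GL (Fin 3) F) * (q.2 : GL (Fin 3) F)))⁻¹ : GL (Fin 3) F) : Matrix (Fin 3) (Fin 3) F)) := fun g m => by
    have hc : Continuous fun q : ↥(glInt 3 F) × ↥(unipotentRadicalGL F (![false, false, true] : Fin 3 → Bool)) =>
        (g * ((q.1 : GL (Fin 3) F) * (q.2 : GL (Fin 3) F)) : GL (Fin 3) F) :=
      continuous_const.mul ((continuous_subtype_val.comp continuous_fst).mul (continuous_subtype_val.comp continuous_snd))
    exact hh.comp (((Units.continuous_val.comp hc).mul continuous_const).mul (Units.continuous_coe_inv.comp hc)).measurable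
  have hF1 := hF 1
  have hq1 := hq 1
  simp only [one_mul] at hF1 hq1
  calc _ = ∫⁻ m : Fin 5 → F, ∫⁻ q : ↥(glInt 3 F) × ↥(unipotentRadicalGL F (![false, false, true] : Fin 3 → Bool)),
          w ((!![m 0, m 1; m 2, m 3] : Matrix (Fin 2) (Fin 2) F).charpoly.eval (m 4)) *
            h (((g * ((q.1 : GL (Fin 3) F) * (q.2 : GL (Fin 3) F)) : GL (Fin 3) F) : Matrix (Fin 3) (Fin 3) F) * !![m 0, m 1, 0; m 2, m 3, 0; 0, 0, m 4] *
              (((g * ((q.1 : GL (Fin 3) F) * (q.2 : GL (Fin 3) F)))⁻¹ : GL (Fin 3) F) : Matrix (Fin 3) (Fin 3) F)) ∂(κ.prod μU) ∂(Measure.pi fun _ : Fin 5 => dx) :=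
        lintegral_congr fun m => (lintegral_const_mul _ (hq g m)).symm
    _ = ∫⁻ q : ↥(glInt 3 F) × ↥(unipotentRadicalGL F (![false, false, true] : Fin 3 → Bool)), ∫⁻ m : Fin 5 → F,
          w ((!![m 0, m 1; m 2, m 3] : Matrix (Fin 2) (Fin 2) F).charpoly.eval (m 4)) *
            h (((g * ((q.1 : GL (Fin 3) F) * (q.2 : GL (Fin 3) F)) : GL (Fin 3) F) : Matrix (Fin 3) (Fin 3) F) * !![m 0, m 1, 0; m 2, m 3, 0; 0, 0, m 4] *
              (((g * ((q.1 : GL (Fin 3) F) * (q.2 : GL (Fin 3) F)))⁻¹ : GL (Fin 3) F) : Matrix (Fin 3) (Fin 3) F)) ∂(Measure.pi fun _ : Fin 5 => dx) ∂(κ.prod μU) :=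
        lintegral_lintegral_swap (hF g).aemeasurable
    _ = ∫⁻ q : ↥(glInt 3 F) × ↥(unipotentRadicalGL F (![false, false, true] : Fin 3 → Bool)), ∫⁻ m : Fin 5 → F,
          w ((!![m 0, m 1; m 2, m 3] : Matrix (Fin 2) (Fin 2) F).charpoly.eval (m 4)) *
            h ((((q.1 : GL (Fin 3) F) * (q.2 : GL (Fin 3) F) : GL (Fin 3) F) : Matrix (Fin 3) (Fin 3) F) * !![m 0, m 1, 0; m 2, m 3, 0; 0, 0, m 4] *
              ((((q.1 : GL (Fin 3) F) * (q.2 : GL (Fin 3) F))⁻¹ : GL (Fin 3) F) : Matrix (Fin 3) (Fin 3) F)) ∂(Measure.pi fun _ : Fin 5 => dx) ∂(κ.prod μU) :=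
        GL3.lintegral_prod_lintegral_pi_conj_leviBlock_eq κ μU dx hw g hh
    _ = ∫⁻ m : Fin 5 → F, ∫⁻ q : ↥(glInt 3 F) × ↥(unipotentRadicalGL F (![false, false, true] : Fin 3 → Bool)),
          w ((!![m 0, m 1; m 2, m 3] : Matrix (Fin 2) (Fin 2) F).charpoly.eval (m 4)) *
            h ((((q.1 : GL (Fin 3) F) * (q.2 : GL (Fin 3) F) : GL (Fin 3) F) : Matrix (Fin 3) (Fin 3) F) * !![m 0, m 1, 0; m 2, m 3, 0; 0, 0, m 4] *
              ((((q.1 : GL (Fin 3) F) * (q.2 : GL (Fin 3) F))⁻¹ : GL (Fin 3) F) : Matrix (Fin 3) (Fin 3) F)) ∂(κ.prod μU) ∂(Measure.pi fun _ : Fin 5 => dx) :=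
        (lintegral_lintegral_swap hF1.aemeasurable).symm
    _ = _ := lintegral_congr fun m => lintegral_const_mul _ (hq1 m)

/-- **(F-E)-D′, the `|·|_F`-weighted instance (ED.2; the road owner's object verbatim).**  For every `g ∈ GL₃(F)` and Borel `h ≥ 0`:
**`∫⁻_m |χ(m)|_F ∫⁻_{K×U} h(Ad(g k u) M(m)) d(κ⊗μ_U) dm = ∫⁻_m |χ(m)|_F ∫⁻_{K×U} h(Ad(k u) M(m)) d(κ⊗μ_U) dm`**
(`GL3.lintegral_pi_mul_lintegral_prod_conj_leviBlock_eq` with `w = normAbs F`, Borel by ★ `LocalFieldHaar.measurable_normAbs`).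
[cite: HarishChandra1970, Part V §2 p. 49] [cite: Rogawski1990, §4.13 p. 70] -/
theorem GL3.lintegral_pi_normAbs_mul_lintegral_prod_conj_leviBlock_eq
    (κ : Measure ↥(glInt 3 F)) [IsHaarMeasure κ] (μU : Measure ↥(unipotentRadicalGL F (![false, false, true] : Fin 3 → Bool))) [IsHaarMeasure μU]
    (dx : Measure F) [dx.IsAddHaarMeasure] (g : GL (Fin 3) F) {h : Matrix (Fin 3) (Fin 3) F → ℝ≥0∞} (hh : Measurable h) :
    ∫⁻ m : Fin 5 → F, (normAbs F ((!![m 0, m 1; m 2, m 3] : Matrix (Fin 2) (Fin 2) F).charpoly.eval (m 4)) : ℝ≥0∞) *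
        ∫⁻ q : ↥(glInt 3 F) × ↥(unipotentRadicalGL F (![false, false, true] : Fin 3 → Bool)),
          h (((g * ((q.1 : GL (Fin 3) F) * (q.2 : GL (Fin 3) F)) : GL (Fin 3) F) : Matrix (Fin 3) (Fin 3) F) * !![m 0, m 1, 0; m 2, m 3, 0; 0, 0, m 4] *
            (((g * ((q.1 : GL (Fin 3) F) * (q.2 : GL (Fin 3) F)))⁻¹ : GL (Fin 3) F) : Matrix (Fin 3) (Fin 3) F)) ∂(κ.prod μU) ∂(Measure.pi fun _ : Fin 5 => dx) =
      ∫⁻ m : Fin 5 → F, (normAbs F ((!![m 0, m 1; m 2, m 3] : Matrix (Fin 2) (Fin 2) F).charpoly.eval (m 4)) : ℝ≥0∞) *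
        ∫⁻ q : ↥(glInt 3 F) × ↥(unipotentRadicalGL F (![false, false, true] : Fin 3 → Bool)),
          h ((((q.1 : GL (Fin 3) F) * (q.2 : GL (Fin 3) F) : GL (Fin 3) F) : Matrix (Fin 3) (Fin 3) F) * !![m 0, m 1, 0; m 2, m 3, 0; 0, 0, m 4] *
            ((((q.1 : GL (Fin 3) F) * (q.2 : GL (Fin 3) F))⁻¹ : GL (Fin 3) F) : Matrix (Fin 3) (Fin 3) F)) ∂(κ.prod μU) ∂(Measure.pi fun _ : Fin 5 => dx) :=
  GL3.lintegral_pi_mul_lintegral_prod_conj_leviBlock_eq κ μU dx (w := fun t => (normAbs F t : ℝ≥0∞))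
    (ENNReal.continuous_coe.measurable.comp LocalFieldHaar.measurable_normAbs) g hh

end GL3

end Summit.HodgeConjecture.HodgeConjecture.Cruxes.H413.K2E3GL3ParabolicSliceAdInvariant

end
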